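import Mathlib.Algebra.MvPolynomial.PDeriv
import Mathlib.Analysis.Calculus.InverseFunctionTheorem.FDeriv
import Mathlib.Geometry.Manifold.MFDeriv.Atlas
import Mathlib.Geometry.Manifold.IsManifold.Basic
import Mathlib.LinearAlgebra.Matrix.Nondegenerate
import Literature.AlgebraicGeometry.Motives.AlgPointsProofs
import Literature.Analysis.Complex.InjectiveHolomorphic
import Literature.NumberTheory.Transcendental.Analytification
import Literature.NumberTheory.Transcendental.AnalytificationProofs
import Literature.NumberTheory.Transcendental.AnalytificationSecondCountableProofs
import HarnessLib

/-!
# Algebraic morphisms are holomorphic on analytifications (proof file)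

Sibling proof file of `Literature/NumberTheory/Transcendental/Analytification.lean`, which vendors
as a *named fact* `Literature.NumberTheory.Transcendental.IsAnalytification.mdifferentiable_comp_map`: if `φ : M → X(ℂ)` and
`ψ : M' → Y(ℂ)` are analytifications (in the sense of `Literature.NumberTheory.Transcendental.IsAnalytification`) of smooth
`k`-schemes `X`, `Y` (`k ⊆ ℂ`) carrying holomorphic atlases, and `g : X ⟶ Y` is a `k`-morphism,
then the induced map `h = ψ⁻¹ ∘ g(ℂ) ∘ φ : M → M'` is holomorphic. This file proves it:
`Literature.NumberTheory.Transcendental.IsAnalytification.mdifferentiable_comp_map_holds`.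

The printed source is Serre, GAGA §2 n°5, p. 9: «si `f : X → Y` est une application régulière
d'une variété algébrique `X` dans une variété algébrique `Y`, `f` est aussi une application
holomorphe de `X^h` dans `Y^h`», which «résulte immédiatement de la définition de `X^h`»
(n°5 Prop. 2: every algebraic chart is an analytic chart of `X^h`; Lemme 1 c): a regular map
between Z-locally-closed subsets of affine spaces is holomorphic; n°6 Prop. 3 Cor. 2 with §1 n°4:
at a simple point, `X^h` is a complex manifold whose local coordinates are regular functions).

## Why this is not immediate here, and the proof

`IsAnalytification E' Y e ψ` does not say that `M'` *is* `Y^h`: it records that `ψ` is a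
homeomorphism onto `Y(ℂ)` (strong topology) and that regular functions pull back to holomorphic
functions on the *given* complex manifold `M'`. To conclude, one must produce holomorphic
coordinates *of `M'`* near `m' = h(m)` among the pulled-back regular functions; that their
differentials span is exactly the Clements–Osgood theorem (an injective holomorphic map between
equidimensional complex manifolds is biholomorphic onto its image, Fritzsche–Grauert I.8.5),
vendored and proved in `Literature/Analysis/Complex/InjectiveHolomorphic.lean`. (Conversely the
fact applied to `X = Y = 𝔸ᵉ`, `g = 𝟙`, `ψ = φ ∘ F` for a holomorphic homeomorphism `F` of `ℂᵉ`
gives back that theorem, so this input is unavoidable.) The proof, at `m ∈ M`, `Q = ψ(h m)`: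

1. *(algebra)* `Y → Spec k` is smooth of relative dimension `e`, so `Q` lies in an affine open `V`
   with `Γ(Y, V) = k[X_i : i ∈ ι]/(f_j : j ∈ σ)` a standard smooth presentation: distinguished
   variables `X_{c(j)}` (`c : σ ↪ ι`), `|ι| - |σ| = e`, and `det (∂f_j/∂X_{c(i)})` a unit of
   `Γ(Y, V)` (Mathlib `SmoothOfRelativeDimension`, `Algebra.SubmersivePresentation`). The
   coordinates `x = (x_i)_i : V(ℂ) → ℂ^ι` are injective (a `ℂ`-point of the affine `V` is the
   `k`-algebra map `Γ(Y, V) → ℂ` "evaluation", `AlgPoints.ext_of_forall_eval_eq`), land in the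
   zero set of the `f_j` (`AlgPoints.eval_map_relation`), and the Jacobian determinant does not
   vanish at `x(Q)` (`AlgPoints.det_eval_pderiv_relation_ne_zero`). This is Serre's Lemme 1 /
   §1 n°4 setting: `V(ℂ) ⊂ ℂ^ι` is the common zero set of polynomials whose Jacobian matrix has
   the right rank at `Q`.
2. *(implicit functions, uniqueness half)* Hence near `x(Q)` a point of `ℂ^ι` is determined by
   its free coordinates `(v_i)_{i ∉ c(σ)}` and the values `f_j(v)` (inverse function theorem for
   `v ↦ ((v_i)_{i ∉ c(σ)}, (f_j(v))_j)`, whose differential — computed by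
   `MvPolynomial.hasStrictFDerivAt_eval` — is invertible; `exists_isOpen_injOn_of_det_ne_zero`).
   So the `e` functions `x_i ∘ ψ` (`i ∉ c(σ)`), holomorphic on `M'` by `IsAnalytification`, are
   *injective* near `m'`.
3. *(Osgood)* Read in a chart `χ'` of `M'` they form an injective holomorphic map `T` between
   open subsets of `e`-dimensional spaces, whose differential at `χ'(m')` is therefore invertible
   (`Literature.Analysis.Complex.SCV.bijective_fderiv_of_injOn`); by the inverse function theorem `T` has a holomorphic
   local inverse.
4. *(Serre's argument)* Near `m`, `h = χ'⁻¹ ∘ T⁻¹ ∘ A` with `A = (x_i ∘ g(ℂ) ∘ φ)_{i ∉ c(σ)}`, and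
   `x_i ∘ g(ℂ) ∘ φ = (g^* x_i) ∘ φ` is a regular function of `X` read on `M`, holomorphic by
   `IsAnalytification` (`AlgPoints.evalOrZero_map`,
   `Literature.NumberTheory.Transcendental.IsAnalytification.mdifferentiableOn_evalOrZero_opens_holds`).

## References

* J.-P. Serre, *Géométrie algébrique et géométrie analytique*, Ann. Inst. Fourier **6** (1956),
  §1 n°4, §2 n°5 (Lemme 1, Prop. 2, and p. 9: fonctorialité de `X ↦ X^h`), n°6 Prop. 3 Cor. 2.
* K. Fritzsche, H. Grauert, *From Holomorphic Functions to Complex Manifolds*, GTM 213 (2002),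
  Ch. I §8, Thm. 8.5, Cor. 8.6 (and §7, implicit and inverse functions).
* A. Grothendieck, M. Raynaud, *SGA 1*, Exp. XII §1.
* R. Hartshorne, *Algebraic Geometry*, II §2 (Ex. 2.7), III §10.
-/

noncomputable section

universe u

open CategoryTheory AlgebraicGeometry Topology Filter
open scoped Manifold ContDiff

namespace Literature.NumberTheory.Transcendental

/-! ### The differential of a polynomial map -/

section MvPolynomialDeriv

variable {𝕜 : Type*} [NontriviallyNormedField 𝕜] {ι : Type*} [Fintype ι]

/-- **The differential of a polynomial map is given by its partial derivatives**: for
`p ∈ 𝕜[Xᵢ : i ∈ ι]` (`ι` finite), the function `v ↦ p(v)` on `𝕜^ι` has strict Fréchet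
derivative `w ↦ ∑ᵢ (∂p/∂Xᵢ)(a) wᵢ` at every point `a` (induction on `p`, Leibniz rule).
[Fritzsche–Grauert, Ch. I §4] [folklore] -/
theorem MvPolynomial.hasStrictFDerivAt_eval (p : MvPolynomial ι 𝕜) (a : ι → 𝕜) :
    HasStrictFDerivAt (fun v : ι → 𝕜 ↦ MvPolynomial.eval v p)
      (∑ i, MvPolynomial.eval a (MvPolynomial.pderiv i p) •
        ContinuousLinearMap.proj (R := 𝕜) (φ := fun _ : ι ↦ 𝕜) i) a := by
  classical
  induction p using MvPolynomial.induction_on with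
  | C c =>
    refine (hasStrictFDerivAt_const (𝕜 := 𝕜) c a).congr_fderiv ?_ |>.congr_of_eventuallyEq ?_
    · ext w
      simp
    · exact Filter.Eventually.of_forall fun v ↦ by simp
  | add p q hp hq =>
    have := hp.add hq
    refine (this.congr_fderiv ?_).congr_of_eventuallyEq
      (Filter.Eventually.of_forall fun v ↦ by simp)
    ext w
    simp only [map_add, add_apply, FunLike.coe_sum, Finset.sum_apply, FunLike.coe_smul,
      Pi.smul_apply, ContinuousLinearMap.proj_apply, smul_eq_mul, add_mul, Finset.sum_add_distrib]
  | mul_X p i hp =>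
    have hX : HasStrictFDerivAt (fun v : ι → 𝕜 ↦ v i)
        (ContinuousLinearMap.proj (R := 𝕜) (φ := fun _ : ι ↦ 𝕜) i) a :=
      (ContinuousLinearMap.proj (R := 𝕜) (φ := fun _ : ι ↦ 𝕜) i).hasStrictFDerivAt
    have := hp.mul hX
    refine (this.congr_fderiv ?_).congr_of_eventuallyEq
      (Filter.Eventually.of_forall fun v ↦ by simp)
    ext w
    simp only [MvPolynomial.pderiv_mul, MvPolynomial.pderiv_X, map_add, map_mul,
      MvPolynomial.eval_X, FunLike.coe_sum, Finset.sum_apply, FunLike.coe_smul, Pi.smul_apply,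
      ContinuousLinearMap.proj_apply, smul_eq_mul, add_apply, Pi.single_apply]
    simp only [apply_ite (MvPolynomial.eval a), map_one, map_zero, mul_ite, mul_one, mul_zero,
      add_mul, Finset.sum_add_distrib, ite_mul, zero_mul, Finset.sum_ite_eq, Finset.mem_univ,
      if_true]
    rw [add_comm, Finset.mul_sum]
    exact congrArg₂ (· + ·) (Finset.sum_congr rfl fun x _ ↦ by ring) rfl

end MvPolynomialDeriv

/-! ### Uniqueness in the implicit function theorem for polynomial relations -/

section ImplicitInj

variable {ι σ : Type*} [Fintype ι] [Fintype σ] [DecidableEq σ]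

/-- **Uniqueness in the implicit function theorem, for polynomial relations.** Let
`F_j ∈ ℂ[X_i : i ∈ ι]` (`j ∈ σ`) be polynomials and `f : σ ↪ ι` distinguished variables such that
the Jacobian `det (∂F_j/∂X_{f i})(c)` is non-zero at `c ∈ ℂ^ι`. Then near `c` a point `v` is
determined by its remaining coordinates `(v_i)_{i ∉ f(σ)}` together with the values `F_j(v)`:
the map `v ↦ ((v_i)_{i ∉ f(σ)}, (F_j(v))_j)` has invertible differential at `c`, hence is
injective on a neighbourhood of `c` (inverse function theorem, Mathlib
`HasStrictFDerivAt.toOpenPartialHomeomorph`). [Fritzsche–Grauert, Ch. I §7–8] [folklore] -/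
theorem exists_isOpen_injOn_of_det_ne_zero (f : σ → ι) (hf : Function.Injective f)
    (F : σ → MvPolynomial ι ℂ) (c : ι → ℂ)
    (hdet : (Matrix.of fun i j : σ ↦
      MvPolynomial.eval c (MvPolynomial.pderiv (f i) (F j))).det ≠ 0) :
    ∃ W : Set (ι → ℂ), IsOpen W ∧ c ∈ W ∧ ∀ v ∈ W, ∀ v' ∈ W,
      (∀ i, i ∉ Set.range f → v i = v' i) →
      (∀ j, MvPolynomial.eval v (F j) = MvPolynomial.eval v' (F j)) → v = v' := by
  classical
  -- the map `Φ = (free coordinates, relations)` and its differential at `c`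
  set Φ : (ι → ℂ) → ({i : ι // i ∉ Set.range f} → ℂ) × (σ → ℂ) :=
    fun v ↦ (fun i ↦ v i.1, fun j ↦ MvPolynomial.eval v (F j)) with hΦ
  set Rκ : (ι → ℂ) →L[ℂ] ({i : ι // i ∉ Set.range f} → ℂ) :=
    ContinuousLinearMap.pi fun i : {i : ι // i ∉ Set.range f} ↦
      ContinuousLinearMap.proj (R := ℂ) (φ := fun _ : ι ↦ ℂ) i.1 with hRκ
  set G : σ → (ι → ℂ) →L[ℂ] ℂ := fun j ↦
    ∑ i, MvPolynomial.eval c (MvPolynomial.pderiv i (F j)) •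
      ContinuousLinearMap.proj (R := ℂ) (φ := fun _ : ι ↦ ℂ) i with hG
  set Φ' : (ι → ℂ) →L[ℂ] ({i : ι // i ∉ Set.range f} → ℂ) × (σ → ℂ) :=
    Rκ.prod (ContinuousLinearMap.pi G) with hΦ'
  have hderiv : HasStrictFDerivAt Φ Φ' c :=
    Rκ.hasStrictFDerivAt.prodMk
      (hasStrictFDerivAt_pi.2 fun j ↦ MvPolynomial.hasStrictFDerivAt_eval (F j) c)
  -- `Φ'` is injective: the free components vanish, then the Jacobian kills the others
  have hinj : Function.Injective Φ' := by
    intro w w' hww'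
    rw [← sub_eq_zero, ← map_sub] at hww'
    rw [← sub_eq_zero]
    set u := w - w' with hu
    have h1 : ∀ i : {i : ι // i ∉ Set.range f}, u i.1 = 0 := fun i ↦ by
      have := congrArg (fun q ↦ q.1 i) hww'
      simpa [hΦ', hRκ] using this
    have h2 : ∀ j, ∑ i, MvPolynomial.eval c (MvPolynomial.pderiv i (F j)) * u i = 0 := fun j ↦ by
      have := congrArg (fun q ↦ q.2 j) hww'
      simpa [hΦ', hG] using this
    have h3 : Matrix.vecMul (fun i ↦ u (f i))
        (Matrix.of fun i j : σ ↦ MvPolynomial.eval c (MvPolynomial.pderiv (f i) (F j))) = 0 := by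
      ext j
      simp only [Matrix.vecMul, dotProduct, Matrix.of_apply, Pi.zero_apply]
      rw [← h2 j]
      symm
      rw [← Finset.sum_subset (Finset.subset_univ (Finset.univ.image f)),
        Finset.sum_image fun a _ b _ h ↦ hf h]
      · exact Finset.sum_congr rfl fun i _ ↦ mul_comm _ _
      · intro l _ hl
        have : l ∉ Set.range f := fun ⟨a, ha⟩ ↦
          hl (Finset.mem_image.2 ⟨a, Finset.mem_univ _, ha⟩)
        rw [h1 ⟨l, this⟩, mul_zero]
    have h4 : (fun i ↦ u (f i)) = 0 := Matrix.eq_zero_of_vecMul_eq_zero hdet h3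
    funext l
    by_cases hl : l ∈ Set.range f
    · obtain ⟨a, rfl⟩ := hl
      exact congrFun h4 a
    · exact h1 ⟨l, hl⟩
  -- hence bijective, by a dimension count
  have hdim : Module.finrank ℂ (ι → ℂ) =
      Module.finrank ℂ (({i : ι // i ∉ Set.range f} → ℂ) × (σ → ℂ)) := by
    simp only [Module.finrank_prod, Module.finrank_fintype_fun_eq_card]
    rw [Fintype.card_subtype_compl, ← Set.card_range_of_injective hf]
    change Fintype.card ι =
      Fintype.card ι - Fintype.card (Set.range f) + Fintype.card (Set.range f)
    rw [Nat.sub_add_cancel (set_fintype_card_le_univ (Set.range f))]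
  have hbij : Function.Bijective Φ' :=
    ⟨hinj, (LinearMap.injective_iff_surjective_of_finrank_eq_finrank hdim).1 hinj⟩
  set Λ : (ι → ℂ) ≃L[ℂ] ({i : ι // i ∉ Set.range f} → ℂ) × (σ → ℂ) :=
    ContinuousLinearEquiv.ofBijective Φ' (LinearMap.ker_eq_bot.2 hbij.1)
      (LinearMap.range_eq_top.2 hbij.2) with hΛ
  have hderiv' : HasStrictFDerivAt Φ (Λ : (ι → ℂ) →L[ℂ] _) c := by
    rw [hΛ, ContinuousLinearEquiv.coe_ofBijective]
    exact hderiv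
  refine ⟨(hderiv'.toOpenPartialHomeomorph Φ).source,
    (hderiv'.toOpenPartialHomeomorph Φ).open_source,
    hderiv'.mem_toOpenPartialHomeomorph_source, fun v hv v' hv' hfree hrel ↦ ?_⟩
  refine (hderiv'.toOpenPartialHomeomorph Φ).injOn hv hv' ?_
  simp only [HasStrictFDerivAt.toOpenPartialHomeomorph_coe, hΦ]
  exact Prod.ext (funext fun i ↦ hfree i.1 i.2) (funext hrel)

end ImplicitInj

/-! ### `L`-points of an affine open in coordinates -/

section AlgPoints
open Literature.AlgebraicGeometry.Motives (AlgPoints)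
open Literature.AlgebraicGeometry.Motives.AlgPoints

variable {k : Type u} [Field k] {X Y : Literature.AlgebraicGeometry.Motives.SchemeOver k} {L : Type u} [Field L] [Algebra k L]

/-- The total evaluation is natural in the scheme: `f(g(P)) = (g^* f)(P)` for `f ∈ Γ(Y, U)`,
with both sides `0` off `U(L)` (`AlgPoints.eval_map`). [Hartshorne II Ex. 2.7] [folklore] -/
theorem _root_.Literature.AlgebraicGeometry.Motives.AlgPoints.evalOrZero_map (g : X ⟶ Y) (U : Y.left.Opens) (f : Γ(Y.left, U)) (P : AlgPoints X L) :
    evalOrZero U f (AlgPoints.map g P) = evalOrZero (g.left ⁻¹ᵁ U) (g.left.app U f) P := by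
  by_cases h : (AlgPoints.map g P).pt ∈ U
  · rw [evalOrZero_of_mem f h, evalOrZero_of_mem _ (show P.pt ∈ g.left ⁻¹ᵁ U from h),
      AlgPoints.eval_map]
  · rw [evalOrZero_of_not_mem f h, evalOrZero_of_not_mem _ (show P.pt ∉ g.left ⁻¹ᵁ U from h)]

/-- **`U(L) = Hom_k(Γ(X, U), L)` for `U` affine (injectivity).** Two `L`-points of an affine open
`V ⊆ X` at which every regular function `a ∈ Γ(X, V)` takes the same value are equal: a morphism
`Spec L → X` landing in `V` is `Spec` of its comorphism `Γ(X, V) → Γ(Spec L, 𝒪) = L`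
(Mathlib `IsAffineOpen.SpecMap_appLE_fromSpec`), which is evaluation (`eval_eq_appLE`).
[Hartshorne II Ex. 2.7 and Prop. 2.3] [folklore] -/
theorem _root_.Literature.AlgebraicGeometry.Motives.AlgPoints.ext_of_forall_eval_eq {V : X.left.Opens} (hV : IsAffineOpen V) {P Q : AlgPoints X L}
    (hP : P.pt ∈ V) (hQ : Q.pt ∈ V) (h : ∀ a : Γ(X.left, V), P.eval V hP a = Q.eval V hQ a) :
    P = Q := by
  haveI : IsAffine (Literature.AlgebraicGeometry.Motives.specOver k L).left := inferInstanceAs (IsAffine (Spec (.of L)))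
  have key : ∀ (R : AlgPoints X L) (hR : R.pt ∈ V),
      (Literature.AlgebraicGeometry.Motives.specOver k L).left.isoSpec.hom ≫ Spec.map (R.left.appLE V ⊤ (R.preimage_eq_top hR).ge) ≫
        hV.fromSpec = R.left := by
    intro R hR
    rw [IsAffineOpen.SpecMap_appLE_fromSpec R.left hV (isAffineOpen_top _),
      IsAffineOpen.fromSpec_top, Iso.hom_inv_id_assoc]
  have happ : P.left.appLE V ⊤ (P.preimage_eq_top hP).ge =
      Q.left.appLE V ⊤ (Q.preimage_eq_top hQ).ge := by
    ext a
    apply (Scheme.ΓSpecIso (.of L)).commRingCatIsoToRingEquiv.injective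
    change (Scheme.ΓSpecIso (.of L)).hom _ = (Scheme.ΓSpecIso (.of L)).hom _
    rw [← eval_eq_appLE, ← eval_eq_appLE]
    exact h a
  ext : 1
  rw [← key P hP, ← key Q hQ, happ]

/-- **Evaluation of a polynomial in regular functions.** Let `V ⊆ X` be an open, made into a
`Γ(Spec k, 𝒪)`-algebra by the structure morphism, `v : ι → Γ(X, V)` regular functions and
`p` a polynomial with coefficients in `Γ(Spec k, 𝒪) = k`. Then the value of `p(v)` at an
`L`-point `P ∈ V(L)` is `p^τ(v(P))`, where `τ : Γ(Spec k, 𝒪) = k → L` (evaluation at `P` is a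
`k`-algebra homomorphism, `eval_appLE_top`). [Hartshorne II Ex. 2.7] [folklore] -/
theorem _root_.Literature.AlgebraicGeometry.Motives.AlgPoints.eval_aeval {V : X.left.Opens} (e : V ≤ X.hom ⁻¹ᵁ ⊤)
    [Algebra Γ(Spec (.of k), ⊤) Γ(X.left, V)]
    (halg : algebraMap Γ(Spec (.of k), ⊤) Γ(X.left, V) = (X.hom.appLE ⊤ V e).hom)
    {ι : Type*} (v : ι → Γ(X.left, V)) (p : MvPolynomial ι Γ(Spec (.of k), ⊤))
    (P : AlgPoints X L) (h : P.pt ∈ V) :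
    P.eval V h (MvPolynomial.aeval v p) =
      MvPolynomial.eval (fun i ↦ P.eval V h (v i))
        (MvPolynomial.map ((algebraMap k L).comp (Scheme.ΓSpecIso (.of k)).hom.hom) p) := by
  -- evaluation at `P` as a ring homomorphism `Γ(X, V) →+* L`
  let ε : Γ(X.left, V) →+* L := (X.left.evaluation V P.pt h ≫ P.resHom).hom
  have hε : ∀ f, P.eval V h f = ε f := fun _ ↦ rfl
  rw [MvPolynomial.eval_map]
  simp only [hε]
  change (ε.comp (MvPolynomial.aeval v).toRingHom) p = MvPolynomial.eval₂Hom _ (fun i ↦ ε (v i)) p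
  congr 1
  refine MvPolynomial.ringHom_ext (fun r ↦ ?_) (fun j ↦ ?_)
  · rw [MvPolynomial.eval₂Hom_C, RingHom.comp_apply, AlgHom.toRingHom_eq_coe,
      AlgHom.coe_toRingHom, ← MvPolynomial.algebraMap_eq, AlgHom.commutes, halg, ← hε]
    exact P.eval_appLE_top h e r
  · simp

/-- **Points of `V(L)` are determined by the values of generators** of the `k`-algebra `Γ(X, V)`
(`V` affine): if `Γ(X, V)` is generated by `v : ι → Γ(X, V)` (a `Generators` structure over
`Γ(Spec k, 𝒪) = k`) and `vᵢ(P) = vᵢ(Q)` for all `i`, then `P = Q`. This is the injectivity of the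
coordinate map `V(L) → L^ι` of an affine chart.
[Hartshorne II Ex. 2.7; Serre, GAGA §2 n°5 Lemme 1] [folklore] -/
theorem _root_.Literature.AlgebraicGeometry.Motives.AlgPoints.ext_of_forall_eval_val_eq {V : X.left.Opens} (hV : IsAffineOpen V) (e : V ≤ X.hom ⁻¹ᵁ ⊤)
    [Algebra Γ(Spec (.of k), ⊤) Γ(X.left, V)]
    (halg : algebraMap Γ(Spec (.of k), ⊤) Γ(X.left, V) = (X.hom.appLE ⊤ V e).hom)
    {ι : Type*} (G : Algebra.Generators Γ(Spec (.of k), ⊤) Γ(X.left, V) ι)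
    {P Q : AlgPoints X L} (hP : P.pt ∈ V) (hQ : Q.pt ∈ V)
    (h : ∀ i, P.eval V hP (G.val i) = Q.eval V hQ (G.val i)) : P = Q := by
  refine ext_of_forall_eval_eq hV hP hQ fun a ↦ ?_
  rw [← G.aeval_val_σ a, eval_aeval e halg G.val (G.σ a) P hP,
    eval_aeval e halg G.val (G.σ a) Q hQ]
  simp only [h]

/-- **The relations of a presentation vanish at `L`-points.** With `V`, `τ` as in `eval_aeval`
and `P` a presentation of the `k`-algebra `Γ(X, V)` (generators `xᵢ = P.val i`, relations
`P.relation j ∈ k[Xᵢ]`), the point `(xᵢ(Q))ᵢ ∈ L^ι` of every `Q ∈ V(L)` is a zero of the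
relations (coefficients mapped to `L`): `V(L)` lies in the Z-closed set they cut out.
[Hartshorne II Ex. 2.7; Serre, GAGA §2 n°5 Lemme 1] [folklore] -/
theorem _root_.Literature.AlgebraicGeometry.Motives.AlgPoints.eval_map_relation {V : X.left.Opens} (e : V ≤ X.hom ⁻¹ᵁ ⊤)
    [Algebra Γ(Spec (.of k), ⊤) Γ(X.left, V)]
    (halg : algebraMap Γ(Spec (.of k), ⊤) Γ(X.left, V) = (X.hom.appLE ⊤ V e).hom)
    {ι σ : Type*} (P : Algebra.Presentation Γ(Spec (.of k), ⊤) Γ(X.left, V) ι σ)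
    (Q : AlgPoints X L) (hQ : Q.pt ∈ V) (j : σ) :
    MvPolynomial.eval (fun i ↦ Q.eval V hQ (P.val i))
      (MvPolynomial.map ((algebraMap k L).comp (Scheme.ΓSpecIso (.of k)).hom.hom)
        (P.relation j)) = 0 := by
  rw [← eval_aeval e halg P.val (P.relation j) Q hQ, P.aeval_val_relation j]
  exact map_zero (X.left.evaluation V Q.pt hQ ≫ Q.resHom).hom

/-- **The Jacobian of a submersive presentation does not vanish at `L`-points.** With `V`, `τ`
as above and `P` a *submersive* presentation of `Γ(X, V)` over `Γ(Spec k, 𝒪) = k` (relations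
`fⱼ`, distinguished variables `X_{P.map i}`, `i, j ∈ σ`, Jacobian `det (∂fⱼ/∂X_{P.map i})` a unit
of `Γ(X, V)`), the Jacobian matrix of the relations (coefficients mapped to `L`) at the point
`(xᵢ(Q))ᵢ` of any `Q ∈ V(L)` has non-zero determinant: evaluation at `Q` is a ring
homomorphism and sends units to units. [SGA1 Exp. II; Serre, GAGA §1 n°4] [folklore] -/
theorem _root_.Literature.AlgebraicGeometry.Motives.AlgPoints.det_eval_pderiv_relation_ne_zero {V : X.left.Opens} (e : V ≤ X.hom ⁻¹ᵁ ⊤)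
    [Algebra Γ(Spec (.of k), ⊤) Γ(X.left, V)]
    (halg : algebraMap Γ(Spec (.of k), ⊤) Γ(X.left, V) = (X.hom.appLE ⊤ V e).hom)
    {ι σ : Type*} [Fintype σ] [DecidableEq σ]
    (P : Algebra.SubmersivePresentation Γ(Spec (.of k), ⊤) Γ(X.left, V) ι σ)
    (Q : AlgPoints X L) (hQ : Q.pt ∈ V) :
    (Matrix.of fun i j : σ ↦ MvPolynomial.eval (fun l ↦ Q.eval V hQ (P.val l))
      (MvPolynomial.pderiv (P.map i)
        (MvPolynomial.map ((algebraMap k L).comp (Scheme.ΓSpecIso (.of k)).hom.hom)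
          (P.relation j)))).det ≠ 0 := by
  set τ : Γ(Spec (.of k), ⊤) →+* L := (algebraMap k L).comp (Scheme.ΓSpecIso (.of k)).hom.hom
    with hτ
  -- evaluation at `Q` as a ring homomorphism `Γ(X, V) →+* L`
  let ε : Γ(X.left, V) →+* L := (X.left.evaluation V Q.pt hQ ≫ Q.resHom).hom
  have hε : ∀ f, Q.eval V hQ f = ε f := fun _ ↦ rfl
  let f : MvPolynomial ι Γ(Spec (.of k), ⊤) →+* L :=
    (MvPolynomial.eval fun l ↦ Q.eval V hQ (P.val l)).comp (MvPolynomial.map τ)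
  have h1 : IsUnit (ε P.jacobian) := P.jacobian_isUnit.map ε
  have h2 : ε P.jacobian = (Matrix.of fun i j : σ ↦
      MvPolynomial.eval (fun l ↦ Q.eval V hQ (P.val l))
        (MvPolynomial.pderiv (P.map i) (MvPolynomial.map τ (P.relation j)))).det := by
    rw [P.jacobian_eq_jacobiMatrix_det, Algebra.Generators.algebraMap_apply, ← hε,
      eval_aeval e halg]
    change f P.jacobiMatrix.det = _
    rw [RingHom.map_det]
    congr 1
    ext i j
    simp only [RingHom.mapMatrix_apply, Matrix.map_apply, Matrix.of_apply,
      Algebra.PreSubmersivePresentation.jacobiMatrix_apply]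
    change MvPolynomial.eval _ (MvPolynomial.map τ _) = _
    rw [MvPolynomial.pderiv_map]
  rw [← h2]
  exact h1.ne_zero

end AlgPoints

/-! ### The theorem -/

namespace IsAnalytification

variable {E : Type*} [NormedAddCommGroup E] [NormedSpace ℂ E] [FiniteDimensional ℂ E]
  {E' : Type*} [NormedAddCommGroup E'] [NormedSpace ℂ E'] [FiniteDimensional ℂ E']
  {M : Type*} [TopologicalSpace M] [ChartedSpace E M]
  {M' : Type*} [TopologicalSpace M'] [ChartedSpace E' M']
  {k : Type} [Field k] [Algebra k ℂ] {X : Literature.AlgebraicGeometry.Motives.SchemeOver k} {d : ℕ} {Y : Literature.AlgebraicGeometry.Motives.SchemeOver k}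
  {φ : M → Literature.AlgebraicGeometry.Motives.ComplexPoints X}

/-- **Algebraic morphisms are holomorphic** (Serre, GAGA §2 n°5, p. 9: «si `f : X → Y` est une
application régulière, `f` est aussi une application holomorphe de `X^h` dans `Y^h`»): the named
fact `Literature.NumberTheory.Transcendental.IsAnalytification.mdifferentiable_comp_map` holds. If `φ : M → X(ℂ)`, `ψ : M' → Y(ℂ)`
are analytifications with holomorphic atlases of the smooth `k`-schemes `X`, `Y` and `g : X ⟶ Y`
is a `k`-morphism, the map `h : M → M'` with `ψ ∘ h = g(ℂ) ∘ φ` is holomorphic. Proof (see the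
module docstring): at `m`, algebraic coordinates `x = (xᵢ)` of an affine open `V ∋ ψ(h m)` with a
standard smooth presentation embed `V(ℂ)` into the zero set of the relations in `ℂ^ι`; by the
(uniqueness half of the) implicit function theorem the free coordinates `(xᵢ ∘ ψ)_{i ∉ c(σ)}` are
injective near `h m` on `M'`, hence (Clements–Osgood, `Literature.Analysis.Complex.SCV.bijective_fderiv_of_injOn`) form
a holomorphic chart `T` of `M'`; and `h = χ'⁻¹ ∘ T⁻¹ ∘ (x_free ∘ g(ℂ) ∘ φ)` near `m`, where
`xᵢ ∘ g(ℂ) ∘ φ = (g^* xᵢ) ∘ φ` is holomorphic on `M`.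
[cite: SerreGAGA1956, §2 n°5 p. 9 (fonctorialité de X^h), with n°5 Lemme 1, Prop. 2 and §1 n°4]
[cite: FritzscheGrauert2002, Ch. I §8 Thm. 8.5] -/
theorem mdifferentiable_comp_map_holds :
    mdifferentiable_comp_map (E := E) (E' := E') (M' := M') (d := d) (Y := Y) (φ := φ) := by
  intro _ _ _ e _ _ _ ψ hφ hψ g h hh m
  classical
  haveI : IsManifold 𝓘(ℂ, E) 1 M := inferInstance
  haveI : IsManifold 𝓘(ℂ, E') 1 M' := inferInstance
  haveI : CompleteSpace E' := FiniteDimensional.complete ℂ E'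
  have hhm : ∀ m'', ψ (h m'') = Literature.AlgebraicGeometry.Motives.AlgPoints.map g (φ m'') := fun m'' ↦ congrFun hh m''
  -- `h = ψ⁻¹ ∘ g(ℂ) ∘ φ` is continuous
  set Ψ : M' ≃ₜ Literature.AlgebraicGeometry.Motives.ComplexPoints Y := hψ.homeomorph with hΨ
  have hcoeΨ : (Ψ : M' → Literature.AlgebraicGeometry.Motives.ComplexPoints Y) = ψ := hψ.coe_homeomorph
  have hh' : h = fun m'' ↦ Ψ.symm (Literature.AlgebraicGeometry.Motives.AlgPoints.map g (φ m'')) := by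
    funext m''
    apply Ψ.injective
    rw [Ψ.apply_symm_apply, hcoeΨ, hhm]
  have hcont : Continuous h := by
    rw [hh']
    exact Ψ.symm.continuous.comp ((Literature.AlgebraicGeometry.Motives.AlgPoints.continuous_map g).comp hφ.isHomeomorph.continuous)
  have hψinj : Function.Injective ψ := hψ.isHomeomorph.injective
  /- Step 1: a standard smooth presentation `Γ(Y, V) = k[Xᵢ]/(fⱼ)` on an affine open `V`
  containing `y = (ψ (h m)).pt` (the base affine open is all of `Spec k`, a one-point space). -/
  obtain ⟨U', hU', V, hV, hyV, eVU, hstd⟩ :=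
    SmoothOfRelativeDimension.exists_isStandardSmoothOfRelativeDimension (n := e) (f := Y.hom)
      (ψ (h m)).pt
  obtain rfl : U' = ⊤ := by
    refine eq_top_iff.2 fun p _ ↦ ?_
    have hy : Y.hom.base (ψ (h m)).pt ∈ U' := eVU hyV
    rwa [Subsingleton.elim p (Y.hom.base (ψ (h m)).pt)]
  letI alg : Algebra Γ(Spec (.of k), ⊤) Γ(Y.left, V) := (Y.hom.appLE ⊤ V eVU).hom.toAlgebra
  have halg : algebraMap Γ(Spec (.of k), ⊤) Γ(Y.left, V) = (Y.hom.appLE ⊤ V eVU).hom := rfl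
  obtain ⟨ι, σ, _, _, P, hPdim⟩ := hstd.toAlgebra.out
  cases nonempty_fintype ι
  cases nonempty_fintype σ
  -- the relations over `ℂ` and the coordinate functions on `Y(ℂ)`
  set F : σ → MvPolynomial ι ℂ := fun j ↦
    MvPolynomial.map ((algebraMap k ℂ).comp (Scheme.ΓSpecIso (.of k)).hom.hom) (P.relation j)
    with hF
  set xf : ι → Literature.AlgebraicGeometry.Motives.ComplexPoints Y → ℂ := fun i ↦ Literature.AlgebraicGeometry.Motives.AlgPoints.evalOrZero V (P.val i) with hxf
  set Q : Literature.AlgebraicGeometry.Motives.ComplexPoints Y := ψ (h m) with hQdef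
  have hQV : Q.pt ∈ V := hyV
  /- Step 2 (algebra): `x : V(ℂ) → ℂ^ι` is injective, lands in the zero set of the `F j`, and
  the Jacobian of the `F j` in the distinguished variables does not vanish at `x(Q)`. -/
  have hrel : ∀ R : Literature.AlgebraicGeometry.Motives.ComplexPoints Y, R.pt ∈ V →
      ∀ j, MvPolynomial.eval (fun i ↦ xf i R) (F j) = 0 := by
    intro R hR j
    have := Literature.AlgebraicGeometry.Motives.AlgPoints.eval_map_relation eVU halg P.toPresentation R hR j
    simp only [hxf, Literature.AlgebraicGeometry.Motives.AlgPoints.evalOrZero_of_mem _ hR]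
    exact this
  have hinjV : ∀ R R' : Literature.AlgebraicGeometry.Motives.ComplexPoints Y, R.pt ∈ V → R'.pt ∈ V →
      (∀ i, xf i R = xf i R') → R = R' := by
    intro R R' hR hR' hx
    refine Literature.AlgebraicGeometry.Motives.AlgPoints.ext_of_forall_eval_val_eq hV eVU halg P.toGenerators hR hR' fun i ↦ ?_
    have := hx i
    simp only [hxf] at this
    rwa [Literature.AlgebraicGeometry.Motives.AlgPoints.evalOrZero_of_mem _ hR, Literature.AlgebraicGeometry.Motives.AlgPoints.evalOrZero_of_mem _ hR'] at this
  have hdet : (Matrix.of fun i j : σ ↦ MvPolynomial.eval (fun l ↦ xf l Q)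
      (MvPolynomial.pderiv (P.map i) (F j))).det ≠ 0 := by
    have := Literature.AlgebraicGeometry.Motives.AlgPoints.det_eval_pderiv_relation_ne_zero eVU halg P Q hQV
    simp only [hxf, Literature.AlgebraicGeometry.Motives.AlgPoints.evalOrZero_of_mem _ hQV]
    exact this
  /- Step 3 (implicit functions): near `x(Q)`, points of `ℂ^ι` in the zero set are determined by
  their free coordinates; hence the free coordinates `xᵢ ∘ ψ`, `i ∉ c(σ)`, are injective on a
  neighbourhood `N₁` of `h m` in `M'`. -/
  obtain ⟨W, hWo, hcW, hWinj⟩ :=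
    exists_isOpen_injOn_of_det_ne_zero P.map P.map_inj F (fun l ↦ xf l Q) hdet
  set N₁ : Set M' := ψ ⁻¹' {R | R.pt ∈ V} ∩ (fun m'' ↦ fun l ↦ xf l (ψ m'')) ⁻¹' W with hN₁
  have hN₁o : IsOpen N₁ := by
    refine ContinuousOn.isOpen_inter_preimage ?_ (hψ.isOpen_preimage V) hWo
    refine continuousOn_pi.2 fun l ↦ ?_
    exact (Literature.AlgebraicGeometry.Motives.AlgPoints.continuousOn_evalOrZero V (P.val l)).comp
      hψ.isHomeomorph.continuous.continuousOn fun m'' hm'' ↦ hm''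
  have hmN₁ : h m ∈ N₁ := ⟨hQV, hcW⟩
  have hinjN₁ : ∀ m₁ ∈ N₁, ∀ m₂ ∈ N₁,
      (∀ i : {i : ι // i ∉ Set.range P.map}, xf i.1 (ψ m₁) = xf i.1 (ψ m₂)) → m₁ = m₂ := by
    intro m₁ hm₁ m₂ hm₂ hfree
    apply hψinj
    refine hinjV _ _ hm₁.1 hm₂.1 fun i ↦ ?_
    have key := hWinj _ hm₁.2 _ hm₂.2 (fun i hi ↦ hfree ⟨i, hi⟩)
      (fun j ↦ by rw [hrel _ hm₁.1, hrel _ hm₂.1])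
    exact congrFun key i
  /- Step 4 (Osgood): in the chart `χ'` of `M'` at `h m`, `T = x_free ∘ ψ ∘ χ'⁻¹` is an
  injective holomorphic map between open subsets of `e`-dimensional spaces, so its differential
  at `χ' (h m)` is invertible and `T` has a holomorphic local inverse. -/
  set χ' : OpenPartialHomeomorph M' E' := chartAt E' (h m) with hχ'
  set O : Set E' := χ'.target ∩ χ'.symm ⁻¹' N₁ with hO
  have hOo : IsOpen O := χ'.isOpen_inter_preimage_symm hN₁o
  set T : E' → ({i : ι // i ∉ Set.range P.map} → ℂ) :=
    fun z i ↦ xf i.1 (ψ (χ'.symm z)) with hT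
  have hz₀ : χ' (h m) ∈ O :=
    ⟨χ'.map_source (mem_chart_source E' (h m)), by
      show χ'.symm (χ' (h m)) ∈ N₁
      rw [χ'.left_inv (mem_chart_source E' (h m))]
      exact hmN₁⟩
  have hyM' : ∀ i, MDifferentiableOn 𝓘(ℂ, E') 𝓘(ℂ, ℂ) (fun m'' ↦ xf i (ψ m''))
      (ψ ⁻¹' {R | R.pt ∈ V}) :=
    fun i ↦ hψ.mdifferentiableOn_evalOrZero ⟨V, hV⟩ (P.val i)
  have hTd : DifferentiableOn ℂ T O := by
    intro z hz
    suffices hd : DifferentiableAt ℂ T z from hd.differentiableWithinAt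
    refine differentiableAt_pi.2 fun i ↦ ?_
    have h1 : MDifferentiableAt 𝓘(ℂ, E') 𝓘(ℂ, ℂ) (fun m'' ↦ xf i.1 (ψ m'')) (χ'.symm z) :=
      (hyM' i.1).mdifferentiableAt ((hψ.isOpen_preimage _).mem_nhds hz.2.1)
    have h2 : MDifferentiableAt 𝓘(ℂ, E') 𝓘(ℂ, E') χ'.symm z :=
      mdifferentiableAt_atlas_symm (chart_mem_atlas E' (h m)) hz.1
    exact mdifferentiableAt_iff_differentiableAt.1 (h1.comp z h2)
  have hTinj : Set.InjOn T O := by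
    intro z hz z' hz' hzz'
    have : χ'.symm z = χ'.symm z' := hinjN₁ _ hz.2 _ hz'.2 fun i ↦ congrFun hzz' i
    rw [← χ'.right_inv hz.1, ← χ'.right_inv hz'.1, this]
  have hcard : Fintype.card {i : ι // i ∉ Set.range P.map} = e := by
    rw [Fintype.card_subtype_compl]
    change Fintype.card ι - Fintype.card (Set.range P.map) = e
    rw [Set.card_range_of_injective P.map_inj, ← hPdim, Algebra.Presentation.dimension,
      Nat.card_eq_fintype_card, Nat.card_eq_fintype_card]
  have hdim : Module.finrank ℂ E' = Module.finrank ℂ ({i : ι // i ∉ Set.range P.map} → ℂ) := by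
    rw [hψ.finrank_eq, Module.finrank_fintype_fun_eq_card, hcard]
  have hbij := Literature.Analysis.Complex.SCV.bijective_fderiv_of_injOn hdim hTd hOo hTinj hz₀
  set Λ : E' ≃L[ℂ] ({i : ι // i ∉ Set.range P.map} → ℂ) :=
    ContinuousLinearEquiv.ofBijective (fderiv ℂ T (χ' (h m))) (LinearMap.ker_eq_bot.2 hbij.1)
      (LinearMap.range_eq_top.2 hbij.2) with hΛ
  have hstrict : HasStrictFDerivAt T (Λ : E' →L[ℂ] _) (χ' (h m)) := by
    rw [hΛ, ContinuousLinearEquiv.coe_ofBijective]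
    exact ((Literature.Analysis.Complex.SCV.contDiffOn_one hTd hOo).contDiffAt (hOo.mem_nhds hz₀)).hasStrictFDerivAt
      one_ne_zero
  /- Step 5 (Serre's argument): `A = x_free ∘ g(ℂ) ∘ φ` is holomorphic at `m`, since
  `xᵢ ∘ g(ℂ) ∘ φ = (g^* xᵢ) ∘ φ` is a regular function of `X` read on `M`. -/
  set A : M → ({i : ι // i ∉ Set.range P.map} → ℂ) :=
    fun m'' i ↦ xf i.1 (Literature.AlgebraicGeometry.Motives.AlgPoints.map g (φ m'')) with hA
  have hAd : MDifferentiableAt 𝓘(ℂ, E) 𝓘(ℂ, {i : ι // i ∉ Set.range P.map} → ℂ) A m := by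
    rw [← mdifferentiableWithinAt_univ]
    refine Literature.Geometry.Kaehler.mdifferentiableWithinAt_pi_space.2 fun i ↦ ?_
    rw [mdifferentiableWithinAt_univ]
    have hgU : MDifferentiableOn 𝓘(ℂ, E) 𝓘(ℂ, ℂ)
        (fun m'' ↦ Literature.AlgebraicGeometry.Motives.AlgPoints.evalOrZero (g.left ⁻¹ᵁ V) (g.left.app V (P.val i.1)) (φ m''))
        (φ ⁻¹' {R | R.pt ∈ g.left ⁻¹ᵁ V}) :=
      mdifferentiableOn_evalOrZero_opens_holds hφ _ _
    have heq : (fun m'' ↦ A m'' i) =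
        fun m'' ↦ Literature.AlgebraicGeometry.Motives.AlgPoints.evalOrZero (g.left ⁻¹ᵁ V) (g.left.app V (P.val i.1)) (φ m'') := by
      funext m''
      simp only [hA, hxf]
      exact Literature.AlgebraicGeometry.Motives.AlgPoints.evalOrZero_map g V (P.val i.1) (φ m'')
    rw [heq]
    refine hgU.mdifferentiableAt ((hφ.isOpen_preimage _).mem_nhds ?_)
    show (Literature.AlgebraicGeometry.Motives.AlgPoints.map g (φ m)).pt ∈ V
    rw [← hhm]
    exact hQV
  -- near `m`, `h = χ'⁻¹ ∘ T⁻¹ ∘ A`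
  have hTA : ∀ m'', h m'' ∈ χ'.source → T (χ' (h m'')) = A m'' := by
    intro m'' hm''
    funext i
    simp only [hT, hA, χ'.left_inv hm'', hhm]
  have hev : h =ᶠ[𝓝 m] fun m'' ↦ χ'.symm (hstrict.localInverse T _ _ (A m'')) := by
    have h1 : ∀ᶠ m'' in 𝓝 m, h m'' ∈ χ'.source :=
      hcont.continuousAt.preimage_mem_nhds (χ'.open_source.mem_nhds (mem_chart_source E' (h m)))
    have h2 : ∀ᶠ m'' in 𝓝 m, hstrict.localInverse T _ _ (T (χ' (h m''))) = χ' (h m'') := by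
      have hc : ContinuousAt (fun m'' ↦ χ' (h m'')) m :=
        (χ'.continuousAt (mem_chart_source E' (h m))).comp hcont.continuousAt
      exact hc.eventually hstrict.eventually_left_inverse
    filter_upwards [h1, h2] with m'' hm1 hm2
    rw [← hTA m'' hm1, hm2, χ'.left_inv hm1]
  refine MDifferentiableAt.congr_of_eventuallyEq ?_ hev
  have hTm : T (χ' (h m)) = A m := hTA m (mem_chart_source E' (h m))
  have h1 : MDifferentiableAt 𝓘(ℂ, {i : ι // i ∉ Set.range P.map} → ℂ) 𝓘(ℂ, E')
      (hstrict.localInverse T _ _) (A m) := by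
    rw [← hTm]
    exact mdifferentiableAt_iff_differentiableAt.2
      hstrict.to_localInverse.hasFDerivAt.differentiableAt
  have h2 : MDifferentiableAt 𝓘(ℂ, E') 𝓘(ℂ, E') χ'.symm (hstrict.localInverse T _ _ (A m)) := by
    rw [← hTm, hstrict.localInverse_apply_image]
    exact mdifferentiableAt_atlas_symm (chart_mem_atlas E' (h m))
      (χ'.map_source (mem_chart_source E' (h m)))
  exact h2.comp m (h1.comp m hAd)

end IsAnalytification

end Literature.NumberTheory.Transcendental
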